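import Mathlib
import Summits.ResolutionOfSingularities.ResolutionOfSingularities.Theorems.WildQuotientsWildQuotientResolutionCyclicTransferInvariants
import Summits.ResolutionOfSingularities.ResolutionOfSingularities.Theorems.WildQuotientsWildQuotientResolutionCyclicTransferIsRegularGlued
import Summits.ResolutionOfSingularities.ResolutionOfSingularities.Theorems.WildQuotientsWildQuotientResolutionCyclicTransferStalkAugRestrict

/-!
# Cyclic divisorial transfer — the glued quotient `X/G` is regular in the Király–Lütkebohmert terminal state

(crux stmt-ResolutionOfSingularities-15640 `WildQuotients.WildQuotientResolution`, line `Sketch`,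
piece A2 of the cyclic divisorial transfer T1; [OURS · L1 W4.5c] — NOT a statement of any
manuscript.)

For an action `ρ` of a finite group `G` of prime order `p` on an integral REGULAR scheme `X`
over a separated, locally Noetherian base `Y` (`r : X → Y` separated, locally of finite type), such
that at every point `x` fixed by `g ∈ G` the augmentation ideal `(g♯ s - s : s ∈ 𝒪_{X,x})` of the
stalk action is principal, the glued quotient `X/G`
(`Literature.AlgebraicGeometry.RelativeSpec.ActionOver.glued`, SGA 1 V §1) is a regular scheme
(`isRegular_glued_of_stalkAug`). By `CyclicTransfer.stub_isRegular_glued` it suffices that the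
chart rings `Γ(O, (O ↪ X → Y)⁻¹U)^G` (`O` a `G`-stable open affine over `Y`, `U ⊆ Y` affine) are
regular; for non-empty `O` this is the chart form `CyclicTransfer.isRegularRing_invariantsRing_of_locallyOfFiniteType`
(Király–Lütkebohmert at fixed primes, Chase–Harrison–Rosenberg flatness and flat descent at moved
primes) applied to the restricted action `ρ.restrict O` — the stalk hypothesis descends to `O` by
`CyclicTransfer.stub_stalkAug_restrict` — and an empty `O` has the zero chart ring
(`isRegularRing_of_subsingleton`).
-/

-- single-problem summit: the doubled namespace component `ResolutionOfSingularities` is forced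
set_option linter.dupNamespace false

noncomputable section

open CategoryTheory Limits AlgebraicGeometry TopologicalSpace
open Literature.AlgebraicGeometry.Resolution Literature.AlgebraicGeometry.RelativeSpec

namespace Summit.ResolutionOfSingularities.ResolutionOfSingularities.Theorems.WildQuotientResolution.CyclicTransfer

/-- The zero ring is a regular ring: it is Noetherian and has no prime ideals. [folklore] -/
theorem isRegularRing_of_subsingleton (R : Type*) [CommRing R] [Subsingleton R] :
    IsRegularRing R :=
  (isRegularRing_iff).mpr fun _ hp => (hp.ne_top (Subsingleton.elim _ _)).elim

/-- **`X/G` is regular in the Király–Lütkebohmert terminal state.** Let the finite group `G` of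
prime order `p` act on the integral REGULAR scheme `X` over the separated, locally Noetherian
base `Y` (`r : X → Y` separated, locally of finite type; `ρ : ActionOver r G`), so that at every
point `x` fixed by `g ∈ G` the augmentation ideal `(g♯ s - s : s ∈ 𝒪_{X,x})` of the stalk action
`stalkSpecializes ≫ g.stalkMap x` is principal. Then the glued quotient `X/G = ρ.glued` is a
regular scheme: by `stub_isRegular_glued` it suffices that the chart rings
`Γ(O, (O ↪ X → Y)⁻¹U)^G` (`O` a `G`-stable open affine over `Y`, `U ⊆ Y` affine) are regular,
which for non-empty (hence integral, regular) `O` is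
`isRegularRing_invariantsRing_of_locallyOfFiniteType` for the restricted action
`ρ.restrict O` (the stalk hypothesis descends to `O` by `stub_stalkAug_restrict`), and for empty
`O` is the regularity of the zero ring. No faithfulness is needed (a chart on which `G` acts
trivially has `Γ^G = Γ`, regular). [cite: KiralyLutkebohmert2013, Thm 2]
[cite: SGA1, Exp. V, §1, Prop. 1.8] -/
theorem isRegular_glued_of_stalkAug {X Y : Scheme.{0}} {r : X ⟶ Y} {G : Type} [Group G]
    [Finite G] (ρ : ActionOver r G) [Y.IsSeparated] [IsSeparated r] [LocallyOfFiniteType r]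
    [IsLocallyNoetherian Y] [IsIntegral X] {p : ℕ} (hp : p.Prime) (hcard : Nat.card G = p)
    (hreg : Scheme.IsRegular X)
    (hdiv : ∀ (g : G) (x : X) (hx : (ρ.aut g).hom.base x = x),
      (Ideal.span (Set.range fun s : X.presheaf.stalk x =>
        (X.presheaf.stalkSpecializes (specializes_of_eq hx) ≫ (ρ.aut g).hom.stalkMap x).hom s -
          s)).IsPrincipal) :
    Scheme.IsRegular ρ.glued := by
  classical
  refine stub_isRegular_glued ρ fun O U => ?_
  rw [ActionOver.invariants_ring]
  rcases ((O.1 : X.Opens) : Set X).eq_empty_or_nonempty with h | h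
  · -- empty `O`: the chart ring is the zero ring
    have hbot : (O.1.ι ≫ r) ⁻¹ᵁ U.1 = ⊥ := by
      ext y
      simp only [Opens.coe_bot, Set.mem_empty_iff_false, iff_false]
      intro
      have : (y.1 : X) ∈ ((O.1 : X.Opens) : Set X) := y.2
      rw [h] at this
      exact this
    haveI : Subsingleton Γ(O.1, (O.1.ι ≫ r) ⁻¹ᵁ U.1) :=
      CommRingCat.subsingleton_of_isTerminal
        ((O.1 : Scheme.{0}).sheaf.isTerminalOfEqEmpty hbot)
    exact isRegularRing_of_subsingleton _
  -- non-empty `O`: an integral regular scheme, affine and of finite type over `Y`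
  haveI : Nonempty (O.1 : Scheme.{0}) := by
    obtain ⟨x, hx⟩ := h
    exact ⟨⟨x, hx⟩⟩
  haveI : IsIntegral (O.1 : Scheme.{0}) := isIntegral_of_isOpenImmersion O.1.ι
  have hOreg : Scheme.IsRegular (O.1 : Scheme.{0}) := fun y => by
    haveI := hreg (O.1.ι.base y)
    exact IsRegularLocalRing.of_ringEquiv (asIso (O.1.ι.stalkMap y)).commRingCatIsoToRingEquiv
  refine isRegularRing_invariantsRing_of_locallyOfFiniteType (ρ.restrict O.1 O.2.1) hp hcard hOreg
    U fun g x hx => ?_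
  -- the stalk hypothesis on `O` from the one on `X`
  have hx' : (ρ.aut g).hom.base x.1 = x.1 := by
    have h1 := ρ.ι_restrictHom_apply O.1 O.2.1 g x
    simp only [Scheme.Opens.ι_apply] at h1
    rw [ActionOver.restrict_aut_hom] at hx
    rw [← h1, hx]
  obtain ⟨hgx', h2⟩ := stub_stalkAug_restrict ρ O.1 O.2.1 g x hx' (hdiv g x.1 hx')
  exact h2

end Summit.ResolutionOfSingularities.ResolutionOfSingularities.Theorems.WildQuotientResolution.CyclicTransfer

end
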